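import Summits.CriticalPhenomena.Ising3D.IsingColumnFaceL11CensusSegmentLinA
import Summits.CriticalPhenomena.Ising3D.IsingColumnFaceL11CensusSegmentLinB

/-!
# The `LIN` census of §7.3 on the certified `Δε` segment as kernel facts, V: parts `2, 4` and the
theorems (cell `pub-ising3x`, seat recog-1; paper §7.1 / §7.3)

HONEST FRAMING: lottery ticket; floor = tightest certified 3D Ising CFT bounds; no exact-solution
claim without a proof. Island framing: certified exclusion region at stated derivative order and
assumptions; not a determination of the 3D Ising critical exponents beyond that.

The last two kernel evaluations of the machine of `IsingColumnFaceL11CensusSegmentLin{,Cands}.lean`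
(≈ 140 s of kernel time) and the ASSEMBLY of all seven (`…SegmentLinA.lean`: parts `0, 5, 6`;
`…SegmentLinB.lean`: parts `1, 3`):
* `linSeg_checked`, `linSegAll_decided` (no tuple of the table has an enclosure straddling a cut point),
  `linSegAll_nodup`;
* `lin_tuple_subwindow_iff` / `lin_tuple_segment_iff` (a tuple of the table `linFamily 12` has its value in
  sub-window `k`, resp. in the segment, iff it is a candidate of bin `k`, resp. `≤ 2`), the real-number form
  `lin_mem_subwindow_iff` (a real number is a `linFamily 12` member in sub-window `k` iff it is the value of
  a bin-`k` candidate: the COMPLETE census), `lin_descr_ncard` (number of primitive descriptions with value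
  in sub-window `k` = the kernel's bin count);
* **`lin_descr_subwindow_ncard`: §7.3's «30 105 / 43 907 / 38 648» are kernel facts** — exactly that many
  primitive descriptions `(a₀, c, aₓ)` of `LIN` take their value in `[81/64, 13/10]` / `[13/10, 27/20]` /
  `[27/20, 2855/2048]`; `lin_descr_segment_ncard`: 112 660 on the whole segment (no description has the
  value `13/10` or `27/20`); `lin_examples_binned` (`2 log 2`, `2 − log 2` where §7.3 puts them).
A statement about the frozen catalogue's density on the certified segment, NOT about `Δε`; the size of the
list is §1.6's point (membership at these widths carries no evidential weight); nothing is recognised; no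
P(M·) relevance. Pure arithmetic over landed definitions and certified enclosures; no certificate, no datum,
no σ–ε axiom.
lottery ticket; floor = tightest certified 3D Ising CFT bounds; no exact-solution claim without a proof.
-/

namespace Summit.CriticalPhenomena.Ising3D
namespace ColumnFaceL11
open Set Literature.MathematicalPhysics.QuantumFieldTheory.ConformalBootstrap3D

/-- Part `2` (2328 vectors): all candidates decided, codes increasing, `5714 / 8392 / 7278` primitive
candidates in the three sub-window bins. [folklore] -/
theorem linSegCheck_p2 : linSegCheck 2 5714 8392 7278 = true := by
  decide +kernel

/-- Part `4` (1176 vectors): all candidates decided, codes increasing, `2895 / 4201 / 3676` primitive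
candidates in the three sub-window bins. [folklore] -/
theorem linSegCheck_p4 : linSegCheck 4 2895 4201 3676 = true := by
  decide +kernel

/-! ### All seven parts are checked -/

/-- The seven part checks, with their counts. [folklore] -/
theorem linSeg_checked : ∀ i, i < 7 → ∃ n0 n1 n2, linSegCheck i n0 n1 n2 = true := by
  intro i hi
  interval_cases i
  · exact ⟨_, _, _, linSegCheck_p0⟩
  · exact ⟨_, _, _, linSegCheck_p1⟩
  · exact ⟨_, _, _, linSegCheck_p2⟩
  · exact ⟨_, _, _, linSegCheck_p3⟩
  · exact ⟨_, _, _, linSegCheck_p4⟩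
  · exact ⟨_, _, _, linSegCheck_p5⟩
  · exact ⟨_, _, _, linSegCheck_p6⟩

/-- Every candidate is decided (bin `≤ 3`): no tuple of the table has an enclosure straddling a cut
point. [folklore] -/
theorem linSegAll_decided {be : (ℕ × Bool) × (ℤ × List ℤ × ℕ)} (hbe : be ∈ linSegAll) : be.1.1 ≤ 3 := by
  obtain ⟨i, hi, hbi⟩ := mem_linSegAll_iff.mp hbe
  obtain ⟨n0, n1, n2, hc⟩ := linSeg_checked i hi
  exact (linSegCheck_spec hc).1 be hbi

/-- The candidate tuples have no duplicates. [folklore] -/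
theorem linSegAll_nodup : (linSegAll.map Prod.snd).Nodup :=
  nodup_linSegAll_snd fun i hi => by
    obtain ⟨n0, n1, n2, hc⟩ := linSeg_checked i hi
    exact (linSegCheck_spec hc).2.1

/-- **The sub-window membership theorem .** For `k = 0, 1, 2`: a
tuple of the table `linFamily 12` has its value in the closed sub-window `[segCutQ k, segCutQ (k+1)]` iff
it is a candidate of bin `k`. [folklore] -/
theorem lin_tuple_subwindow_iff {k : ℕ} (hk : k < 3) (e : ℤ × List ℤ × ℕ) :
    (linTupleOK 12 e = true ∧ ((segCutQ k : ℚ) : ℝ) ≤ lin7TupleVal e ∧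
        lin7TupleVal e ≤ ((segCutQ (k + 1) : ℚ) : ℝ)) ↔ ((k, linPrim e), e) ∈ linSegAll := by
  have hc01 : ((segCutQ 0 : ℚ) : ℝ) < ((segCutQ 1 : ℚ) : ℝ) := by norm_num [segCutQ]
  have hc12 : ((segCutQ 1 : ℚ) : ℝ) < ((segCutQ 2 : ℚ) : ℝ) := by norm_num [segCutQ]
  have hc23 : ((segCutQ 2 : ℚ) : ℝ) < ((segCutQ 3 : ℚ) : ℝ) := by norm_num [segCutQ]
  obtain ⟨a0, c, ax⟩ := e
  constructor
  · rintro ⟨hok, hlo, hhi⟩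
    have hlo0 : ((segCutQ 0 : ℚ) : ℝ) ≤ lin7TupleVal (a0, c, ax) := by
      interval_cases k
      · exact hlo
      · exact hc01.le.trans hlo
      · exact (hc01.le.trans hc12.le).trans hlo
    have hhi3 : lin7TupleVal (a0, c, ax) ≤ ((segCutQ 3 : ℚ) : ℝ) := by
      interval_cases k
      · exact hhi.trans (hc12.le.trans hc23.le)
      · exact hhi.trans hc23.le
      · exact hhi
    have hmem := mem_linSegAll_of_mem_segment hok hlo0 hhi3
    have hax : 0 < ax := linTupleOK_ax_pos hok
    have hdec : linBinOf (a0, c, ax) ≤ 3 := linSegAll_decided hmem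
    obtain ⟨s0, s1, s2, s3⟩ := linBinOf_spec a0 c hax
    have hb : linBinOf (a0, c, ax) = k := by
      interval_cases k
      · interval_cases hb : linBinOf (a0, c, ax)
        · rfl
        · linarith [(s1 rfl).1]
        · linarith [(s2 rfl).1]
        · rcases s3 rfl with h3 | h3 <;> linarith
      · interval_cases hb : linBinOf (a0, c, ax)
        · linarith [(s0 rfl).2]
        · rfl
        · linarith [(s2 rfl).1]
        · rcases s3 rfl with h3 | h3 <;> linarith
      · interval_cases hb : linBinOf (a0, c, ax)
        · linarith [(s0 rfl).2]
        · linarith [(s1 rfl).2]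
        · rfl
        · rcases s3 rfl with h3 | h3 <;> linarith
    rw [hb] at hmem
    exact hmem
  · intro hmem
    obtain ⟨hshape, hok, -⟩ := linSegAll_shape hmem
    have hok : linTupleOK 12 (a0, c, ax) = true := hok
    have hb : linBinOf (a0, c, ax) = k := by
      have := congrArg (fun t : (ℕ × Bool) × (ℤ × List ℤ × ℕ) => t.1.1) hshape
      simpa using this.symm
    obtain ⟨s0, s1, s2, -⟩ := linBinOf_spec a0 c (linTupleOK_ax_pos hok)
    refine ⟨hok, ?_⟩
    interval_cases k
    · exact ⟨(s0 hb).1, (s0 hb).2.le⟩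
    · exact ⟨(s1 hb).1.le, (s1 hb).2.le⟩
    · exact ⟨(s2 hb).1.le, (s2 hb).2⟩

/-- **The segment membership theorem .** A tuple of the table has its
value in the certified segment `[81/64, 2855/2048]` iff it is a candidate of bin `≤ 2`. [folklore] -/
theorem lin_tuple_segment_iff (e : ℤ × List ℤ × ℕ) :
    (linTupleOK 12 e = true ∧ ((segCutQ 0 : ℚ) : ℝ) ≤ lin7TupleVal e ∧
        lin7TupleVal e ≤ ((segCutQ 3 : ℚ) : ℝ)) ↔ (((linBinOf e, linPrim e), e) ∈ linSegAll ∧ linBinOf e ≤ 2) := by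
  have hc01 : ((segCutQ 0 : ℚ) : ℝ) < ((segCutQ 1 : ℚ) : ℝ) := by norm_num [segCutQ]
  have hc12 : ((segCutQ 1 : ℚ) : ℝ) < ((segCutQ 2 : ℚ) : ℝ) := by norm_num [segCutQ]
  have hc23 : ((segCutQ 2 : ℚ) : ℝ) < ((segCutQ 3 : ℚ) : ℝ) := by norm_num [segCutQ]
  obtain ⟨a0, c, ax⟩ := e
  constructor
  · rintro ⟨hok, hlo, hhi⟩
    have hmem := mem_linSegAll_of_mem_segment hok hlo hhi
    have hax : 0 < ax := linTupleOK_ax_pos hok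
    have hdec : linBinOf (a0, c, ax) ≤ 3 := linSegAll_decided hmem
    obtain ⟨-, -, -, s3⟩ := linBinOf_spec a0 c hax
    refine ⟨hmem, ?_⟩
    by_contra hne
    have h3 : linBinOf (a0, c, ax) = 3 := by omega
    rcases s3 h3 with h3 | h3 <;> linarith
  · rintro ⟨hmem, hb⟩
    obtain ⟨-, hok, -⟩ := linSegAll_shape hmem
    have hok : linTupleOK 12 (a0, c, ax) = true := hok
    obtain ⟨s0, s1, s2, -⟩ := linBinOf_spec a0 c (linTupleOK_ax_pos hok)
    refine ⟨hok, ?_⟩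
    interval_cases hbk : linBinOf (a0, c, ax)
    · exact ⟨(s0 rfl).1, (s0 rfl).2.le.trans (hc12.le.trans hc23.le)⟩
    · exact ⟨hc01.le.trans (s1 rfl).1.le, (s1 rfl).2.le.trans hc23.le⟩
    · exact ⟨(hc01.le.trans hc12.le).trans (s2 rfl).1.le, (s2 rfl).2⟩

/-- **Real-number form.** For `k = 0, 1, 2`: a real number is a member of `linFamily 12`
lying in the closed sub-window `k` iff it is the value of a candidate tuple of bin `k`. [folklore] -/
theorem lin_mem_subwindow_iff {k : ℕ} (hk : k < 3) (x : ℝ) :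
    (x ∈ linFamily 12 ∧ ((segCutQ k : ℚ) : ℝ) ≤ x ∧ x ≤ ((segCutQ (k + 1) : ℚ) : ℝ)) ↔
      ∃ be ∈ linSegAll, be.1.1 = k ∧ x = lin7TupleVal be.2 := by
  constructor
  · rintro ⟨⟨a0, c, ax, hlen, h1, h2, hb, hf, hne, rfl⟩, hlo, hhi⟩
    have hok : linTupleOK 12 (a0, c, ax) = true := by
      simp only [linTupleOK, Bool.and_eq_true, decide_eq_true_eq, List.all_eq_true]
      exact ⟨⟨⟨⟨⟨hlen, h1⟩, h2⟩, fun y hy => hb y hy⟩, hf⟩, hne⟩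
    have hmem := (lin_tuple_subwindow_iff hk (a0, c, ax)).mp ⟨hok, hlo, hhi⟩
    exact ⟨_, hmem, rfl, rfl⟩
  · rintro ⟨be, hbe, hb, rfl⟩
    obtain ⟨hshape, -, -⟩ := linSegAll_shape hbe
    have hbin : linBinOf be.2 = k := by
      have hb' := hb; rw [hshape] at hb'; simpa using hb'
    have hmem : ((k, linPrim be.2), be.2) ∈ linSegAll := by
      rw [← hbin]; rw [hshape] at hbe; exact hbe
    obtain ⟨hok', hlo, hhi⟩ := (lin_tuple_subwindow_iff hk be.2).mpr hmem
    exact ⟨mem_linFamily_of_linTupleOK hok', hlo, hhi⟩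

/-- **Counting .** For `k = 0, 1, 2`: the number of PRIMITIVE
descriptions `(a₀, c, aₓ)` of the table `linFamily 12` with value in the closed sub-window `k` equals the
kernel's count of primitive candidates of bin `k`. [folklore] -/
theorem lin_descr_ncard {k : ℕ} (hk : k < 3) :
    {e : ℤ × List ℤ × ℕ | linTupleOK 12 e = true ∧ linPrim e = true ∧ ((segCutQ k : ℚ) : ℝ) ≤ lin7TupleVal e ∧
        lin7TupleVal e ≤ ((segCutQ (k + 1) : ℚ) : ℝ)}.ncard =
      linSegAll.countP (fun be => be.1.1 == k && be.1.2) := by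
  classical
  set M := (linSegAll.filter fun be => be.1.1 == k && be.1.2).map Prod.snd with hM
  have hiff : ∀ e, e ∈ {e : ℤ × List ℤ × ℕ | linTupleOK 12 e = true ∧ linPrim e = true ∧
      ((segCutQ k : ℚ) : ℝ) ≤ lin7TupleVal e ∧ lin7TupleVal e ≤ ((segCutQ (k + 1) : ℚ) : ℝ)} ↔ e ∈ M := by
    intro e
    rw [hM, List.mem_map]
    simp only [Set.mem_setOf_eq, List.mem_filter, Bool.and_eq_true, beq_iff_eq]
    constructor
    · rintro ⟨hok, hprim, hlo, hhi⟩
      have hmem := (lin_tuple_subwindow_iff hk e).mp ⟨hok, hlo, hhi⟩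
      rw [hprim] at hmem
      exact ⟨_, ⟨hmem, rfl, rfl⟩, rfl⟩
    · rintro ⟨be, ⟨hbe, hb, hp⟩, rfl⟩
      obtain ⟨hshape, -, -⟩ := linSegAll_shape hbe
      have hprim : linPrim be.2 = true := by
        have hp' := hp; rw [hshape] at hp'; simpa using hp'
      have hbin : linBinOf be.2 = k := by
        have hb' := hb; rw [hshape] at hb'; simpa using hb'
      have hmem : ((k, linPrim be.2), be.2) ∈ linSegAll := by
        rw [← hbin]; rw [hshape] at hbe; exact hbe
      obtain ⟨hok, hlo, hhi⟩ := (lin_tuple_subwindow_iff hk be.2).mpr hmem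
      exact ⟨hok, hprim, hlo, hhi⟩
  have hnd : M.Nodup := by
    rw [hM]
    exact linSegAll_nodup.sublist (List.filter_sublist.map Prod.snd)
  rw [set_ncard_eq_length_of_iff hnd hiff, hM, List.length_map, List.countP_eq_length_filter]

/-- **Counting on the whole segment** (as a candidate count). [folklore] -/
theorem lin_descr_segment_ncard_countP :
    {e : ℤ × List ℤ × ℕ | linTupleOK 12 e = true ∧ linPrim e = true ∧ ((segCutQ 0 : ℚ) : ℝ) ≤ lin7TupleVal e ∧
        lin7TupleVal e ≤ ((segCutQ 3 : ℚ) : ℝ)}.ncard =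
      linSegAll.countP (fun be => decide (be.1.1 ≤ 2) && be.1.2) := by
  classical
  set M := (linSegAll.filter fun be => decide (be.1.1 ≤ 2) && be.1.2).map Prod.snd with hM
  have hiff : ∀ e, e ∈ {e : ℤ × List ℤ × ℕ | linTupleOK 12 e = true ∧ linPrim e = true ∧
      ((segCutQ 0 : ℚ) : ℝ) ≤ lin7TupleVal e ∧ lin7TupleVal e ≤ ((segCutQ 3 : ℚ) : ℝ)} ↔ e ∈ M := by
    intro e
    rw [hM, List.mem_map]
    simp only [Set.mem_setOf_eq, List.mem_filter, Bool.and_eq_true, decide_eq_true_eq]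
    constructor
    · rintro ⟨hok, hprim, hlo, hhi⟩
      obtain ⟨hmem, hb⟩ := (lin_tuple_segment_iff e).mp ⟨hok, hlo, hhi⟩
      rw [hprim] at hmem
      exact ⟨_, ⟨hmem, hb, rfl⟩, rfl⟩
    · rintro ⟨be, ⟨hbe, hb, hp⟩, rfl⟩
      obtain ⟨hshape, -, -⟩ := linSegAll_shape hbe
      have hprim : linPrim be.2 = true := by
        have hp' := hp; rw [hshape] at hp'; simpa using hp'
      have hbin : linBinOf be.2 ≤ 2 := by
        have hb' := hb; rw [hshape] at hb'; simpa using hb'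
      have hmem : ((linBinOf be.2, linPrim be.2), be.2) ∈ linSegAll := by
        rw [hshape] at hbe; exact hbe
      obtain ⟨hok, hlo, hhi⟩ := (lin_tuple_segment_iff be.2).mpr ⟨hmem, hbin⟩
      exact ⟨hok, hprim, hlo, hhi⟩
  have hnd : M.Nodup := by
    rw [hM]
    exact linSegAll_nodup.sublist (List.filter_sublist.map Prod.snd)
  rw [set_ncard_eq_length_of_iff hnd hiff, hM, List.length_map, List.countP_eq_length_filter]


/-! ### The census numbers of §7.3 -/

/-- Splitting the «bin ≤ 2» count into the three bins. [folklore] -/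
theorem countP_bin_le_two (L : List ((ℕ × Bool) × (ℤ × List ℤ × ℕ))) :
    L.countP (fun be => decide (be.1.1 ≤ 2) && be.1.2) =
      L.countP (fun be => be.1.1 == 0 && be.1.2) + L.countP (fun be => be.1.1 == 1 && be.1.2) +
        L.countP (fun be => be.1.1 == 2 && be.1.2) := by
  induction L with
  | nil => simp
  | cons be L ih =>
      obtain ⟨⟨b, p⟩, e⟩ := be
      simp only [List.countP_cons, ih]
      rcases Nat.lt_or_ge b 3 with hb | hb
      · interval_cases b <;> cases p <;> simp <;> omega
      · have h0 : (b == 0) = false := by rw [beq_eq_false_iff_ne]; omega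
        have h1 : (b == 1) = false := by rw [beq_eq_false_iff_ne]; omega
        have h2 : (b == 2) = false := by rw [beq_eq_false_iff_ne]; omega
        have h3 : decide (b ≤ 2) = false := by rw [decide_eq_false_iff_not]; omega
        simp [h0, h1, h2, h3]

/-- The three primitive bin counts of the whole candidate list: `30105 / 43907 / 38648`. [folklore] -/
theorem linSegAll_counts :
    linSegAll.countP (fun be => be.1.1 == 0 && be.1.2) = 30105 ∧
      linSegAll.countP (fun be => be.1.1 == 1 && be.1.2) = 43907 ∧
      linSegAll.countP (fun be => be.1.1 == 2 && be.1.2) = 38648 := by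
  obtain ⟨-, -, a0, a1, a2⟩ := linSegCheck_spec linSegCheck_p0
  obtain ⟨-, -, b0, b1, b2⟩ := linSegCheck_spec linSegCheck_p1
  obtain ⟨-, -, c0, c1, c2⟩ := linSegCheck_spec linSegCheck_p2
  obtain ⟨-, -, d0, d1, d2⟩ := linSegCheck_spec linSegCheck_p3
  obtain ⟨-, -, e0, e1, e2⟩ := linSegCheck_spec linSegCheck_p4
  obtain ⟨-, -, f0, f1, f2⟩ := linSegCheck_spec linSegCheck_p5
  obtain ⟨-, -, g0, g1, g2⟩ := linSegCheck_spec linSegCheck_p6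
  refine ⟨?_, ?_, ?_⟩
  · rw [countP_linSegAll, a0, b0, c0, d0, e0, f0, g0]
  · rw [countP_linSegAll, a1, b1, c1, d1, e1, f1, g1]
  · rw [countP_linSegAll, a2, b2, c2, d2, e2, f2, g2]

/-- **§7.3's `LIN` census numbers are kernel facts: 30 105 / 43 907 / 38 648.** The number of primitive
descriptions `(a₀, c, aₓ)` of the frozen table `LIN` (`linTupleOK 12`: seven coefficients in `[−12, 12]`, at
most two non-zero, not all zero, `1 ≤ aₓ ≤ 12`; `gcd(a₀, aₓ, c) = 1`) whose value `(a₀ + Σ cᵢKᵢ)/aₓ` lies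
in the closed sub-window `[81/64, 13/10]`, resp. `[13/10, 27/20]`, resp. `[27/20, 2855/2048]`, is exactly
`30105`, resp. `43907`, resp. `38648` (the recogniser's census of record and the cell's further independent
implementations print the same numbers; here the kernel decides every membership by the certified
enclosures). A statement about the catalogue's density on the certified segment, NOT about `Δε`; nothing
is recognised. [folklore] -/
theorem lin_descr_subwindow_ncard :
    {e : ℤ × List ℤ × ℕ | linTupleOK 12 e = true ∧ linPrim e = true ∧ ((segCutQ 0 : ℚ) : ℝ) ≤ lin7TupleVal e ∧
        lin7TupleVal e ≤ ((segCutQ 1 : ℚ) : ℝ)}.ncard = 30105 ∧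
    {e : ℤ × List ℤ × ℕ | linTupleOK 12 e = true ∧ linPrim e = true ∧ ((segCutQ 1 : ℚ) : ℝ) ≤ lin7TupleVal e ∧
        lin7TupleVal e ≤ ((segCutQ 2 : ℚ) : ℝ)}.ncard = 43907 ∧
    {e : ℤ × List ℤ × ℕ | linTupleOK 12 e = true ∧ linPrim e = true ∧ ((segCutQ 2 : ℚ) : ℝ) ≤ lin7TupleVal e ∧
        lin7TupleVal e ≤ ((segCutQ 3 : ℚ) : ℝ)}.ncard = 38648 := by
  obtain ⟨h0, h1, h2⟩ := linSegAll_counts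
  exact ⟨(lin_descr_ncard (k := 0) (by norm_num)).trans h0, (lin_descr_ncard (k := 1) (by norm_num)).trans h1,
    (lin_descr_ncard (k := 2) (by norm_num)).trans h2⟩

/-- **On the whole certified segment `[81/64, 2855/2048]`: exactly 112 660 primitive `LIN` descriptions**
(`= 30105 + 43907 + 38648`: no description takes the value `13/10` or `27/20` — every candidate is binned
strictly off the interior cut points). [folklore] -/
theorem lin_descr_segment_ncard :
    {e : ℤ × List ℤ × ℕ | linTupleOK 12 e = true ∧ linPrim e = true ∧ ((segCutQ 0 : ℚ) : ℝ) ≤ lin7TupleVal e ∧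
        lin7TupleVal e ≤ ((segCutQ 3 : ℚ) : ℝ)}.ncard = 112660 := by
  obtain ⟨h0, h1, h2⟩ := linSegAll_counts
  rw [lin_descr_segment_ncard_countP, countP_bin_le_two, h0, h1, h2]

/-- **The simplest members sit where §7.3 says** (instances of the binning, by the same enclosures):
`2 log 2` (`(0 + 2·log 2)/1`, bin `2`: in `[27/20, 2855/2048]`) and `2 − log 2` (bin `1`: in
`[13/10, 27/20]`). [folklore] -/
theorem lin_examples_binned :
    linBinOf (0, [0, 0, 0, 2, 0, 0, 0], 1) = 2 ∧ linBinOf (2, [0, 0, 0, -1, 0, 0, 0], 1) = 1 := by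
  constructor <;> decide +kernel

end ColumnFaceL11
end Summit.CriticalPhenomena.Ising3D
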